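import Summits.CriticalPhenomena.PercolationContinuityZ3.Theses.PercNearOneGluing
import Summits.CriticalPhenomena.PercolationContinuityZ3.Theorems.PercNearOneGluingAdditiveGluingEdgeAffine
import HarnessLib

/-!
# Crux `PercNearOneGluing.AdditiveGluing` (stmt-CriticalPhenomena-4576): the minimiser-tie reduction
# (registered stub `stub_additiveGluingOfMinTie_k34`)

Support file (`--supports stmt-CriticalPhenomena-4576`, lead prim-png-lead-4576).  No definitions, no named facts, no sorries.

**Theorem (`stub_additiveGluingOfMinTie_k34`).**  If the additive gluing inequality
`μ_w(o ↔ A) − t ≤ μ_w(o ↔ b)` (for all `t ≥ 0` with `μ_w(a ↔ b) ≥ 1 − t` on `A`) holds for every weighted graph and relay set in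
which the two LEAST reliable relays tie (`∃ a ≠ a' ∈ A`, `μ(a↔b) = μ(a'↔b) = min_A μ(·↔b)`), then it holds in general
(`AdditiveGluing`).

Proof (Kozma–Nitzan's "inductive approach", arXiv:2401.12397 §5.3, run on the minimiser): strong induction on the number of
pairs `e` with fractional weight `0 < w e < 1`.  With no fractional pair every weight is `0` or `1` and the inequality is the landed
deterministic base case `agBody_of_zeroOne`.  Otherwise let `a₀` be the (w.l.o.g. unique, else the hypothesis applies) minimiser of
`μ_w(·↔b)` on `A` and `e` a fractional pair; along `s ↦ w[e ↦ s]` every probability is affine (`real_update_affine`, from the landed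
one-bond decomposition), so `F(s) = μ_s(o↔b) − μ_s(o↔A) + 1 − μ_s(a₀↔b)` and the gaps `g_c(s) = μ_s(c↔b) − μ_s(a₀↔b)` (`c ∈ A ∖ a₀`) are
affine on `[0,1]`, with `g_c(w e) > 0`.  On the maximal interval around `w e` on which all `g_c ≥ 0` the function `F` is affine and
nonnegative at both ends — an end is either `0`/`1` (fewer fractional pairs, `a₀` still a minimiser: induction) or a zero of some `g_c`
(a minimiser tie: hypothesis) — hence `F(w e) ≥ 0`.  The interval argument is the elementary `affine_nonneg_of_boundary` below
(induction on the number of constraints, no suprema).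
[cite: KozmaNitzan2024, §5.3 (p. 34), Lemma 13]
-/

namespace Summit.CriticalPhenomena.PercolationContinuityZ3.Theorems

open MeasureTheory Set
open Literature.Probability.LatticeModels Literature.Probability.Percolation

noncomputable section
open Classical

/-! ### An elementary fact about affine functions under affine constraints -/

/-- **Affine functions under affine constraints.**  Let `f` and `g c` (`c ∈ G`) be affine functions on `ℝ`, `lo ≤ s₀ ≤ hi`, all
`g c s₀ > 0`.  If `f s ≥ 0` at every `s ∈ [lo, hi]` at which all constraints `g c s ≥ 0` hold and which is an endpoint or a zero of some
constraint, then `f s₀ ≥ 0`.  (Induction on `G`: a constraint that is nonnegative on the whole interval is dropped; otherwise its zero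
on the side where it fails becomes a new endpoint.) [folklore] -/
theorem affine_nonneg_of_boundary {ι : Type*} (G : Finset ι) (f : ℝ → ℝ) (g : ι → ℝ → ℝ)
    (hf : ∃ α β : ℝ, ∀ s, f s = α + β * s) (hg : ∀ c ∈ G, ∃ α β : ℝ, ∀ s, g c s = α + β * s) :
    ∀ (lo hi s₀ : ℝ), lo ≤ s₀ → s₀ ≤ hi → (∀ c ∈ G, 0 < g c s₀) →
      (∀ s : ℝ, lo ≤ s → s ≤ hi → (∀ c ∈ G, 0 ≤ g c s) → (s = lo ∨ s = hi ∨ ∃ c ∈ G, g c s = 0) → 0 ≤ f s) →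
      0 ≤ f s₀ := by
  obtain ⟨αf, βf, hF⟩ := hf
  induction G using Finset.induction_on with
  | empty =>
    intro lo hi s₀ hlo hhi _ hbd
    have h0 : 0 ≤ f lo := hbd lo le_rfl (hlo.trans hhi) (by simp) (Or.inl rfl)
    have h1 : 0 ≤ f hi := hbd hi (hlo.trans hhi) le_rfl (by simp) (Or.inr (Or.inl rfl))
    rw [hF] at h0 h1 ⊢
    -- `s₀` is a convex combination of `lo` and `hi`
    by_cases hlt : lo < hi
    · have hθ : 0 ≤ (s₀ - lo) / (hi - lo) ∧ (s₀ - lo) / (hi - lo) ≤ 1 := by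
        constructor
        · exact div_nonneg (by linarith) (by linarith)
        · rw [div_le_one (by linarith)]; linarith
      have hne : hi - lo ≠ 0 := by linarith
      have hmul : (s₀ - lo) / (hi - lo) * (hi - lo) = s₀ - lo := div_mul_cancel₀ _ hne
      have key : (1 - (s₀ - lo) / (hi - lo)) * (αf + βf * lo) + (s₀ - lo) / (hi - lo) * (αf + βf * hi) =
          αf + βf * (lo + (s₀ - lo) / (hi - lo) * (hi - lo)) := by ring
      rw [hmul] at key
      have key' : (1 - (s₀ - lo) / (hi - lo)) * (αf + βf * lo) + (s₀ - lo) / (hi - lo) * (αf + βf * hi) = αf + βf * s₀ := by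
        rw [key]; ring
      rw [← key']
      exact add_nonneg (mul_nonneg (by linarith [hθ.2]) h0) (mul_nonneg hθ.1 h1)
    · have : s₀ = lo := le_antisymm (by linarith) hlo
      rw [this]; exact h0
  | insert c₀ G hc₀ ih =>
    intro lo hi s₀ hlo hhi hpos hbd
    have hgG : ∀ c ∈ G, ∃ α β : ℝ, ∀ s, g c s = α + β * s := fun c hc => hg c (Finset.mem_insert_of_mem hc)
    obtain ⟨α₀, β₀, hg₀⟩ := hg c₀ (Finset.mem_insert_self c₀ G)
    have hpos₀ : 0 < g c₀ s₀ := hpos c₀ (Finset.mem_insert_self c₀ G)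
    have hposG : ∀ c ∈ G, 0 < g c s₀ := fun c hc => hpos c (Finset.mem_insert_of_mem hc)
    by_cases hA : ∀ s, lo ≤ s → s ≤ hi → 0 ≤ g c₀ s
    · -- the constraint `c₀` is idle on `[lo, hi]`: drop it
      refine ih hgG lo hi s₀ hlo hhi hposG ?_
      intro s hl hh hG hdis
      refine hbd s hl hh ?_ ?_
      · intro c hc
        rcases Finset.mem_insert.1 hc with rfl | hc
        · exact hA s hl hh
        · exact hG c hc
      · rcases hdis with h | h | ⟨c, hc, h⟩
        · exact Or.inl h
        · exact Or.inr (Or.inl h)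
        · exact Or.inr (Or.inr ⟨c, Finset.mem_insert_of_mem hc, h⟩)
    · push Not at hA
      obtain ⟨s₁, hl₁, hh₁, hneg⟩ := hA
      -- the zero `r` of `g c₀` between `s₀` and `s₁`
      have hβ : β₀ ≠ 0 := by
        intro hβ
        rw [hg₀] at hpos₀ hneg
        rw [hβ] at hpos₀ hneg
        linarith
      set r : ℝ := -α₀ / β₀ with hr
      have hgr : g c₀ r = 0 := by
        rw [hg₀, hr]; field_simp; ring
      have hgs₀ : g c₀ s₀ = β₀ * (s₀ - r) := by rw [hg₀, hr]; field_simp; ring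
      have hgs₁ : g c₀ s₁ = β₀ * (s₁ - r) := by rw [hg₀, hr]; field_simp; ring
      have hglin : ∀ s, g c₀ s = β₀ * (s - r) := fun s => by rw [hg₀, hr]; field_simp; ring
      rcases lt_or_gt_of_ne hβ with hβneg | hβpos
      · -- `g c₀` decreasing: `s₀ < r < s₁`; work on `[lo, r]`
        have hs₀r : s₀ < r := by
          rw [hgs₀] at hpos₀
          by_contra h; push Not at h
          have : β₀ * (s₀ - r) ≤ 0 := mul_nonpos_of_nonpos_of_nonneg hβneg.le (by linarith)
          linarith
        have hrs₁ : r < s₁ := by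
          rw [hgs₁] at hneg
          by_contra h; push Not at h
          have : 0 ≤ β₀ * (s₁ - r) := mul_nonneg_of_nonpos_of_nonpos hβneg.le (by linarith)
          linarith
        have hrhi : r ≤ hi := by linarith
        refine ih hgG lo r s₀ hlo hs₀r.le hposG ?_
        intro s hl hh hG hdis
        have hc₀s : 0 ≤ g c₀ s := by
          rw [hglin]; exact mul_nonneg_of_nonpos_of_nonpos hβneg.le (by linarith)
        refine hbd s hl (hh.trans hrhi) ?_ ?_
        · intro c hc
          rcases Finset.mem_insert.1 hc with rfl | hc
          · exact hc₀s
          · exact hG c hc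
        · rcases hdis with h | h | ⟨c, hc, h⟩
          · exact Or.inl h
          · exact Or.inr (Or.inr ⟨c₀, Finset.mem_insert_self c₀ G, by rw [h, hgr]⟩)
          · exact Or.inr (Or.inr ⟨c, Finset.mem_insert_of_mem hc, h⟩)
      · -- `g c₀` increasing: `s₁ < r < s₀`; work on `[r, hi]`
        have hrs₀ : r < s₀ := by
          rw [hgs₀] at hpos₀
          by_contra h; push Not at h
          have : β₀ * (s₀ - r) ≤ 0 := mul_nonpos_of_nonneg_of_nonpos hβpos.le (by linarith)
          linarith
        have hs₁r : s₁ < r := by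
          rw [hgs₁] at hneg
          by_contra h; push Not at h
          have : 0 ≤ β₀ * (s₁ - r) := mul_nonneg hβpos.le (by linarith)
          linarith
        have hlor : lo ≤ r := by linarith
        refine ih hgG r hi s₀ hrs₀.le hhi hposG ?_
        intro s hl hh hG hdis
        have hc₀s : 0 ≤ g c₀ s := by
          rw [hglin]; exact mul_nonneg hβpos.le (by linarith)
        refine hbd s (hlor.trans hl) hh ?_ ?_
        · intro c hc
          rcases Finset.mem_insert.1 hc with rfl | hc
          · exact hc₀s
          · exact hG c hc
        · rcases hdis with h | h | ⟨c, hc, h⟩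
          · exact Or.inr (Or.inr ⟨c₀, Finset.mem_insert_self c₀ G, by rw [h, hgr]⟩)
          · exact Or.inr (Or.inl h)
          · exact Or.inr (Or.inr ⟨c, Finset.mem_insert_of_mem hc, h⟩)

/-! ### Fractional pairs -/

variable {n : ℕ}

/-- The set of fractional pairs after setting one pair to `0` or `1` is the old one minus that pair. -/
theorem tieRed_fracFilter_update (w : Sym2 (Fin n) → unitInterval) (e : Sym2 (Fin n)) (q : unitInterval)
    (hq : (q : ℝ) = 0 ∨ (q : ℝ) = 1) :
    Finset.univ.filter (fun e' : Sym2 (Fin n) => 0 < (Function.update w e q e' : ℝ) ∧ (Function.update w e q e' : ℝ) < 1) =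
      (Finset.univ.filter (fun e' : Sym2 (Fin n) => 0 < (w e' : ℝ) ∧ (w e' : ℝ) < 1)).erase e := by
  ext e'
  simp only [Finset.mem_filter, Finset.mem_univ, true_and, Finset.mem_erase]
  by_cases h : e' = e
  · subst h
    simp only [Function.update_self, ne_eq, not_true_eq_false, false_and, iff_false, not_and, not_lt]
    intro h0
    rcases hq with h1 | h1
    · rw [h1] at h0; exact absurd h0 (lt_irrefl 0)
    · rw [h1]
  · rw [Function.update_of_ne h]
    simp [h]

/-- The fractional count drops when a fractional pair is set to `0` or `1`. -/
theorem tieRed_fracCard_update_lt (w : Sym2 (Fin n) → unitInterval) (e : Sym2 (Fin n)) (q : unitInterval)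
    (hq : (q : ℝ) = 0 ∨ (q : ℝ) = 1) (h0 : 0 < (w e : ℝ)) (h1 : (w e : ℝ) < 1) :
    (Finset.univ.filter (fun e' : Sym2 (Fin n) => 0 < (Function.update w e q e' : ℝ) ∧
        (Function.update w e q e' : ℝ) < 1)).card <
      (Finset.univ.filter (fun e' : Sym2 (Fin n) => 0 < (w e' : ℝ) ∧ (w e' : ℝ) < 1)).card := by
  rw [tieRed_fracFilter_update w e q hq]
  exact Finset.card_erase_lt_of_mem (Finset.mem_filter.2 ⟨Finset.mem_univ _, h0, h1⟩)

/-! ### The reduction -/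

/-- **Registered stub `stub_additiveGluingOfMinTie_k34`: `AdditiveGluing` follows from its instances with a tie at the
minimum** (two distinct relays `a ≠ a'` with `μ(a↔b) = μ(a'↔b) = min_A μ(·↔b)`).  Strong induction on the number of fractional
pairs; base `agBody_of_zeroOne`; step: one-edge affine interpolation on the maximal interval on which the unique minimiser stays a
minimiser (`affine_nonneg_of_boundary`). [cite: KozmaNitzan2024, §5.3 (p. 34), Lemma 13] -/
theorem stub_additiveGluingOfMinTie_k34 :
    (∀ (n : ℕ) (w : Sym2 (Fin n) → unitInterval) (A : Finset (Fin n)) (o b : Fin n),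
      (∃ a ∈ A, ∃ a' ∈ A, a ≠ a' ∧ (prodBernoulli w).real (openConn a b) = (prodBernoulli w).real (openConn a' b) ∧
        ∀ c ∈ A, (prodBernoulli w).real (openConn a b) ≤ (prodBernoulli w).real (openConn c b)) →
      ∀ t : ℝ, 0 ≤ t → (∀ a ∈ A, 1 - t ≤ (prodBernoulli w).real (openConn a b)) →
        (prodBernoulli w).real (⋃ a ∈ A, openConn o a) - t ≤ (prodBernoulli w).real (openConn o b)) →
    Summit.CriticalPhenomena.PercolationContinuityZ3.Theses.PercNearOneGluing.AdditiveGluing := by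
  intro hTie n
  -- strong induction on the number of fractional pairs
  suffices H : ∀ k : ℕ, ∀ w : Sym2 (Fin n) → unitInterval,
      (Finset.univ.filter (fun e : Sym2 (Fin n) => 0 < (w e : ℝ) ∧ (w e : ℝ) < 1)).card = k →
      ∀ (A : Finset (Fin n)) (o b : Fin n) (t : ℝ), 0 ≤ t →
        (∀ a ∈ A, 1 - t ≤ (prodBernoulli w).real (openConn a b)) →
        (prodBernoulli w).real (⋃ a ∈ A, openConn o a) - t ≤ (prodBernoulli w).real (openConn o b) by
    intro w A o b t ht hrel
    exact H _ w rfl A o b t ht hrel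
  intro k
  induction k using Nat.strong_induction_on with
  | _ k ih =>
  intro w hk A o b t ht hrel
  have hIH : ∀ w' : Sym2 (Fin n) → unitInterval,
      (Finset.univ.filter (fun e : Sym2 (Fin n) => 0 < (w' e : ℝ) ∧ (w' e : ℝ) < 1)).card <
        (Finset.univ.filter (fun e : Sym2 (Fin n) => 0 < (w e : ℝ) ∧ (w e : ℝ) < 1)).card →
      ∀ (A' : Finset (Fin n)) (o' b' : Fin n) (t' : ℝ), 0 ≤ t' →
        (∀ a ∈ A', 1 - t' ≤ (prodBernoulli w').real (openConn a b')) →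
        (prodBernoulli w').real (⋃ a ∈ A', openConn o' a) - t' ≤ (prodBernoulli w').real (openConn o' b') := by
    intro w' hlt A' o' b' t' ht' hrel'
    exact ih _ (hk ▸ hlt) w' rfl A' o' b' t' ht' hrel'
  -- trivial cases
  rcases A.eq_empty_or_nonempty with hAe | hAne
  · subst hAe
    simp only [Finset.notMem_empty, Set.iUnion_of_empty, Set.iUnion_empty, measureReal_empty]
    linarith [measureReal_nonneg (μ := prodBernoulli w) (s := openConn o b)]
  -- the minimiser `a₀`
  obtain ⟨a₀, ha₀, hmin⟩ := Finset.exists_min_image A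
    (fun a => (prodBernoulli w).real (openConn a b : Set (BondConfig (Fin n)))) hAne
  -- a tie at the minimum: the hypothesis
  by_cases htie : ∃ c ∈ A, c ≠ a₀ ∧ (prodBernoulli w).real (openConn c b) = (prodBernoulli w).real (openConn a₀ b)
  · obtain ⟨c, hc, hca, hceq⟩ := htie
    exact hTie n w A o b ⟨a₀, ha₀, c, hc, hca.symm, hceq.symm, hmin⟩ t ht hrel
  push Not at htie
  -- it suffices to prove the inequality with `t = 1 − μ(a₀ ↔ b)`
  have hta₀ : 1 - t ≤ (prodBernoulli w).real (openConn a₀ b) := hrel a₀ ha₀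
  suffices hmain : 0 ≤ (prodBernoulli w).real (openConn o b) - (prodBernoulli w).real (⋃ a ∈ A, openConn o a) +
      (1 - (prodBernoulli w).real (openConn a₀ b)) by linarith
  -- no fractional pair: deterministic base case
  by_cases hfr : ∃ e : Sym2 (Fin n), 0 < (w e : ℝ) ∧ (w e : ℝ) < 1
  swap
  · push Not at hfr
    have hw01 : ∀ e, w e = 0 ∨ w e = 1 := by
      intro e
      have h0 : 0 ≤ (w e : ℝ) := (w e).2.1
      have h1 : (w e : ℝ) ≤ 1 := (w e).2.2
      rcases h0.lt_or_eq with hpos | hzero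
      · right; exact Subtype.ext (le_antisymm h1 (hfr e hpos))
      · left; exact Subtype.ext hzero.symm
    have h1t : 0 ≤ 1 - (prodBernoulli w).real (openConn a₀ b : Set (BondConfig (Fin n))) := by
      linarith [measureReal_le_one (μ := prodBernoulli w) (s := openConn a₀ b)]
    have key := agBody_of_zeroOne w hw01 A o b (1 - (prodBernoulli w).real (openConn a₀ b)) h1t
      (fun a ha => by have := hmin a ha; linarith)
    linarith
  obtain ⟨e, he0, he1⟩ := hfr
  -- the one-edge interpolation `w_s = w[e ↦ s]`
  set w0 : Sym2 (Fin n) → unitInterval := Function.update w e 0 with hw0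
  set w1 : Sym2 (Fin n) → unitInterval := Function.update w e 1 with hw1
  let P0 : Set (BondConfig (Fin n)) → ℝ := fun S => (prodBernoulli w0).real S
  let P1 : Set (BondConfig (Fin n)) → ℝ := fun S => (prodBernoulli w1).real S
  let L : Set (BondConfig (Fin n)) → ℝ → ℝ := fun S s => P0 S + s * (P1 S - P0 S)
  have hL : ∀ (S : Set (BondConfig (Fin n))) (s : ℝ), s ∈ Set.Icc (0:ℝ) 1 →
      (prodBernoulli (Function.update w e (Set.projIcc (0:ℝ) 1 zero_le_one s))).real S = L S s :=
    fun S s hs => real_update_affine w e S hs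
  -- at `s = w e` the interpolation is `w` itself
  have hwe : Function.update w e (Set.projIcc (0:ℝ) 1 zero_le_one (w e : ℝ)) = w := by
    have : Set.projIcc (0:ℝ) 1 zero_le_one (w e : ℝ) = w e := by
      rw [Set.projIcc_of_mem _ ⟨(w e).2.1, (w e).2.2⟩]
    rw [this, Function.update_eq_self]
  have hwe_mem : ((w e : ℝ)) ∈ Set.Icc (0:ℝ) 1 := ⟨(w e).2.1, (w e).2.2⟩
  -- the affine target and constraints
  let f : ℝ → ℝ := fun s => L (openConn o b) s - L (⋃ a ∈ A, openConn o a) s + (1 - L (openConn a₀ b) s)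
  let g : Fin n → ℝ → ℝ := fun c s => L (openConn c b) s - L (openConn a₀ b) s
  have hf_aff : ∃ α β : ℝ, ∀ s, f s = α + β * s :=
    ⟨P0 (openConn o b) - P0 (⋃ a ∈ A, openConn o a) + (1 - P0 (openConn a₀ b)),
      (P1 (openConn o b) - P0 (openConn o b)) - (P1 (⋃ a ∈ A, openConn o a) - P0 (⋃ a ∈ A, openConn o a))
        - (P1 (openConn a₀ b) - P0 (openConn a₀ b)), fun s => by simp only [f, L]; ring⟩
  have hg_aff : ∀ c ∈ A.erase a₀, ∃ α β : ℝ, ∀ s, g c s = α + β * s := fun c _ =>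
    ⟨P0 (openConn c b) - P0 (openConn a₀ b),
      (P1 (openConn c b) - P0 (openConn c b)) - (P1 (openConn a₀ b) - P0 (openConn a₀ b)), fun s => by simp only [g, L]; ring⟩
  -- values of the interpolation at a parameter `s ∈ [0,1]`
  have hval : ∀ s : ℝ, ∀ hs : s ∈ Set.Icc (0:ℝ) 1, ∀ S : Set (BondConfig (Fin n)),
      L S s = (prodBernoulli (Function.update w e (Set.projIcc (0:ℝ) 1 zero_le_one s))).real S :=
    fun s hs S => (hL S s hs).symm
  -- strict positivity of the constraints at `s₀ = w e` (no tie, `a₀` the minimiser)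
  have hpos : ∀ c ∈ A.erase a₀, 0 < g c (w e : ℝ) := by
    intro c hc
    obtain ⟨hca, hcA⟩ := Finset.mem_erase.1 hc
    have h1 := hmin c hcA
    have h2 := htie c hcA hca
    have hlt : (prodBernoulli w).real (openConn a₀ b) < (prodBernoulli w).real (openConn c b) := lt_of_le_of_ne h1 (Ne.symm h2)
    simp only [g]
    rw [hval _ hwe_mem, hval _ hwe_mem, hwe]
    linarith
  -- the boundary hypothesis of `affine_nonneg_of_boundary`
  have hbd : ∀ s : ℝ, 0 ≤ s → s ≤ 1 → (∀ c ∈ A.erase a₀, 0 ≤ g c s) →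
      (s = 0 ∨ s = 1 ∨ ∃ c ∈ A.erase a₀, g c s = 0) → 0 ≤ f s := by
    intro s hs0 hs1 hG hdis
    have hs : s ∈ Set.Icc (0:ℝ) 1 := ⟨hs0, hs1⟩
    set ws : Sym2 (Fin n) → unitInterval := Function.update w e (Set.projIcc (0:ℝ) 1 zero_le_one s) with hws
    -- `a₀` is a minimiser at `w_s`
    have hmin_s : ∀ c ∈ A, (prodBernoulli ws).real (openConn a₀ b) ≤ (prodBernoulli ws).real (openConn c b) := by
      intro c hcA
      by_cases hca : c = a₀
      · rw [hca]
      · have := hG c (Finset.mem_erase.2 ⟨hca, hcA⟩)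
        simp only [g] at this
        rw [hval s hs, hval s hs] at this
        linarith
    have ht_s : 0 ≤ 1 - (prodBernoulli ws).real (openConn a₀ b : Set (BondConfig (Fin n))) := by
      linarith [measureReal_le_one (μ := prodBernoulli ws) (s := openConn a₀ b)]
    have hrel_s : ∀ a ∈ A, 1 - (1 - (prodBernoulli ws).real (openConn a₀ b)) ≤ (prodBernoulli ws).real (openConn a b) :=
      fun a ha => by have := hmin_s a ha; linarith
    -- the inequality at `w_s` with `t_s = 1 − μ_s(a₀ ↔ b)` gives `0 ≤ f s`
    have hgoal : (prodBernoulli ws).real (⋃ a ∈ A, openConn o a) - (1 - (prodBernoulli ws).real (openConn a₀ b)) ≤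
        (prodBernoulli ws).real (openConn o b) → 0 ≤ f s := by
      intro h
      simp only [f]
      rw [hval s hs, hval s hs, hval s hs]
      linarith
    apply hgoal
    rcases hdis with h0 | h1 | ⟨c, hc, hzero⟩
    · -- `s = 0`: fewer fractional pairs, induction
      have hws0 : ws = w0 := by
        rw [hws, hw0, h0]
        congr 1
        exact Subtype.ext (by simp [Set.projIcc])
      rw [hws0]
      refine hIH w0 ?_ A o b _ (by rw [← hws0]; exact ht_s) (by rw [← hws0]; exact hrel_s)
      exact tieRed_fracCard_update_lt w e 0 (Or.inl rfl) he0 he1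
    · -- `s = 1`: fewer fractional pairs, induction
      have hws1 : ws = w1 := by
        rw [hws, hw1, h1]
        congr 1
        exact Subtype.ext (by simp [Set.projIcc])
      rw [hws1]
      refine hIH w1 ?_ A o b _ (by rw [← hws1]; exact ht_s) (by rw [← hws1]; exact hrel_s)
      exact tieRed_fracCard_update_lt w e 1 (Or.inr rfl) he0 he1
    · -- a tie of `c ≠ a₀` with `a₀` at the minimum: the hypothesis
      obtain ⟨hca, hcA⟩ := Finset.mem_erase.1 hc
      have hceq : (prodBernoulli ws).real (openConn c b) = (prodBernoulli ws).real (openConn a₀ b) := by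
        simp only [g] at hzero
        rw [hval s hs, hval s hs] at hzero
        linarith
      exact hTie n ws A o b ⟨a₀, ha₀, c, hcA, Ne.symm hca, hceq.symm, hmin_s⟩ _ ht_s hrel_s
  -- conclude with the affine lemma at `s₀ = w e`
  have key := affine_nonneg_of_boundary (A.erase a₀) f g hf_aff hg_aff 0 1 (w e : ℝ) (w e).2.1 (w e).2.2 hpos hbd
  simp only [f] at key
  rw [hval _ hwe_mem, hval _ hwe_mem, hval _ hwe_mem, hwe] at key
  linarith

end

end Summit.CriticalPhenomena.PercolationContinuityZ3.Theorems
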